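import Mathlib
import Summits.Ventures.PercRepro.PuncturedLYMUnif46Table

/-!
# PercRepro — (SP) FOR ANY NUMBER OF PAIRWISE DISJOINT `4`-SETS AT LEVEL `6`: THE ROW IDENTITIES (3)
(p10, gen 40)

For each row class: the `4(k − Σ c_v)` new-member directions at `raw … 0`, the `(4 − v) c_v` directions into a member met in
`v` points at `raw … v` (`1 ≤ v ≤ 2`), the `c_3` member columns at `1/4`, and the free directions at `raw … 4` add up to
`#Y / #P = Yc / Pc`, as identities of rational functions in `(n, k)` (`field_simp` with `Qp, Pp, Pc` as atoms, then `ring`).  Nothing here asserts (SP).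
-/

namespace PercRepro.PuncturedLYM.Split.TypeLift.Unif46

set_option maxHeartbeats 4000000 in
set_option maxRecDepth 20000 in
/-- The row identity of the class `(1, 1, 1)`. -/
theorem row_111 (n k : ℚ) (hQ : Qp n k ≠ 0) (hP : Pp n k ≠ 0) (hPc : Pc n k ≠ 0) :
    4 * (k - 3) * raw n k 1 1 1 0 + 3 * 1 * raw n k 1 1 1 1 + 2 * 1 * raw n k 1 1 1 2 + 1 / 4 + (n - 4 * k - 0) * raw n k 1 1 1 4 = Yc n / Pc n k := by
  simp (config := {decide := true}) only [raw, sel, sel_111, if_true, if_false]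
  field_simp
  unfold Qp Pp Yc Pc N_111_D0 N_111_D1 N_111_D2 N_111_F
  ring

set_option maxHeartbeats 4000000 in
set_option maxRecDepth 20000 in
/-- The row identity of the class `(2, 2, 0)`. -/
theorem row_220 (n k : ℚ) (hQ : Qp n k ≠ 0) (hP : Pp n k ≠ 0) (hPc : Pc n k ≠ 0) :
    4 * (k - 4) * raw n k 2 2 0 0 + 3 * 2 * raw n k 2 2 0 1 + 2 * 2 * raw n k 2 2 0 2 + (n - 4 * k - 0) * raw n k 2 2 0 4 = Yc n / Pc n k := by
  simp (config := {decide := true}) only [raw, sel, sel_220, if_true, if_false]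
  field_simp
  unfold Qp Pp Yc Pc N_220_D0 N_220_D1 N_220_D2 N_220_F
  ring

set_option maxHeartbeats 4000000 in
set_option maxRecDepth 20000 in
/-- The row identity of the class `(3, 0, 1)`. -/
theorem row_301 (n k : ℚ) (hQ : Qp n k ≠ 0) (hP : Pp n k ≠ 0) (hPc : Pc n k ≠ 0) :
    4 * (k - 4) * raw n k 3 0 1 0 + 3 * 3 * raw n k 3 0 1 1 + 1 / 4 + (n - 4 * k - 0) * raw n k 3 0 1 4 = Yc n / Pc n k := by
  simp (config := {decide := true}) only [raw, sel, sel_301, if_true, if_false]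
  field_simp
  unfold Qp Pp Yc Pc N_301_D0 N_301_D1 N_301_F
  ring

set_option maxHeartbeats 4000000 in
set_option maxRecDepth 20000 in
/-- The row identity of the class `(4, 1, 0)`. -/
theorem row_410 (n k : ℚ) (hQ : Qp n k ≠ 0) (hP : Pp n k ≠ 0) (hPc : Pc n k ≠ 0) :
    4 * (k - 5) * raw n k 4 1 0 0 + 3 * 4 * raw n k 4 1 0 1 + 2 * 1 * raw n k 4 1 0 2 + (n - 4 * k - 0) * raw n k 4 1 0 4 = Yc n / Pc n k := by
  simp (config := {decide := true}) only [raw, sel, sel_410, if_true, if_false]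
  field_simp
  unfold Qp Pp Yc Pc N_410_D0 N_410_D1 N_410_D2 N_410_F
  ring

set_option maxHeartbeats 4000000 in
set_option maxRecDepth 20000 in
/-- The row identity of the class `(6, 0, 0)`. -/
theorem row_600 (n k : ℚ) (hQ : Qp n k ≠ 0) (hP : Pp n k ≠ 0) (hPc : Pc n k ≠ 0) :
    4 * (k - 6) * raw n k 6 0 0 0 + 3 * 6 * raw n k 6 0 0 1 + (n - 4 * k - 0) * raw n k 6 0 0 4 = Yc n / Pc n k := by
  simp (config := {decide := true}) only [raw, sel, sel_600, if_true, if_false]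
  field_simp
  unfold Qp Pp Yc Pc N_600_D0 N_600_D1 N_600_F
  ring

end PercRepro.PuncturedLYM.Split.TypeLift.Unif46
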